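import Summits.BirchSwinnertonDyer.BirchSwinnertonDyer.Theorems.GoldfeldAllTwistsTwoConverseTwinBirchLemmaKrizLi7Twists
import Summits.BirchSwinnertonDyer.Rank1Residual.X12.O11.RouteUMemberE24
import Summits.BirchSwinnertonDyer.Rank1Residual.X12.O11.RouteUMemberE40
import HarnessLib

set_option linter.dupNamespace false -- namespace `…BirchSwinnertonDyer.BirchSwinnertonDyer…` is the cell's (D-0017 nested layout)
set_option autoImplicit false

/-!
# LINE B49, file 4e — Kriz–Li Thm. 1.20 at `p = 7` for `X₀(49)` over EVERY `2`-ramified Heegner field: Heegner points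
# of infinite order and `ord_{s=1} L(49a1^{(−n)}, s) = 1` on the WHOLE Heegner half of the additive-at-`2` cell (unit locus)

Cell `bsd-goldfeld`, seat `bsd-goldfeld-s1p-c301` (prover, gen 5). `--supports` the S1⁺ route items
stmt-BirchSwinnertonDyer-20044 (K12₂″ `…Theses.GoldfeldAllTwistsTwoConverse.RankOneTwoConverseCMSevenAdditiveTwo`) and 19140
(twin″). Files 4 / 4b of the line did the inert PRIME family `49a1^{(−q)}` (`K = ℚ(√−q)`, `d_K = −4q`). Nothing in that
proof used primality beyond "`−4q` is a fundamental discriminant with `7` split": this file runs the SAME instantiation of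
`KrizLi2019.thm120_padicLogHeegner_unit_of_bernoulli` (`E = X₀(49) = cm7`, `p = 7` additive Eisenstein, `ψ = ω²`, the
lifted Kronecker character mod `4n`, bsd-cm's ROUTE U even-member layers `exists_kroneckerFour` /
`isPrimitive_kroneckerFour` / `isKroneckerCharacterOf_kroneckerFour` / `thetaOneK_apply` / `psiJ_inv_isPrimitive`, which are
stated for any squarefree `n ≡ 1, 2 (mod 4)` coprime to `7`) over EVERY imaginary quadratic `K` with `4 ∣ d_K` and `7`
split — i.e. over every `2`-RAMIFIED Heegner field of `X₀(49)`, the «Heegner half» of seat c201's leaf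
`X049KLevelTwoConverseEvenDiscr` / sub-leaf `X049HeegnerNonTorsionEvenDiscr` (`…GoldfeldK12AdditiveTwoRamifiedHeegner`). The
corresponding twists `X₀(49)^{(d_K)} ≅ 49a1^{(−n)}` (`d_K = −4n`) are ALL the negative additive-at-`2` twists `d = −n`,
`n ≡ 1, 2 (mod 4)` squarefree, `(−n/7) = +1` — half of the additive cell by Chebotarev, versus the density-zero prime
family. The price is unchanged: the Bernoulli certificate `7 ∤ B_{1,ε_{−4n}ω⁴}` (decidable per `n`; heuristically `6/7`
of the `n`; its positive proportion is NOT in print — Kohnen–Ono-type results give `≫ √X/log X` only). HONEST FRAMING: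
RANK axis at `p = 7` only; no `p = 2` content; the ∀-statement K12₂″ and twin″ are untouched and stay OPEN; BSD is not
proved by any of this; a closed item would close a rung leaf only.

## Contents (THEOREMS ONLY; no `def`, no instance, no named fact; published inputs = cite-tagged binders BY NAME)
* §1 `bernoulli_hypothesis_cm7_of_cert_evenDiscr` — the fact's binder `hB` from ONE certificate, any `d_K = −4n`.
* §2 **T1′** `not_isOfFinAddOrder_heegnerPoint_cm7_of_thm120_evenDiscr`: KL19 ∧ certificate(n) ⟹ every level-`49` Heegner
  point over `K` (`d_K = −4n`, `(−n/7) = +1`) has infinite order (`n` squarefree `≡ 1, 2 (mod 4)` is READ OFF `d_K`,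
  `Quadratic.isFundamentalDiscriminant_discr`; `7 ∤ n` from `(−n/7) = 1`).
* §3 **T2′** `analyticRankEK_cm7_eq_one_of_thm120_evenDiscr` (`ord L(X₀(49)/K) = 1`),
  `analyticRank_eq_one_negTwist_of_thm120_evenDiscr` («D(n)»: `ord_{s=1} L(W, s) = 1` for every elliptic `W ≅ 49a1^{(−n)}`),
  `rankOneTwoConverse_negTwist_of_thm120_evenDiscr` (K12₂″'s conclusion outright on the Heegner-half unit locus).
* §4 the two COMPOSITE members already certified by bsd-cm's even members `E24` / `E40` (`n = 6, 10`; `(−6/7) = (−10/7) = +1`):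
  `not_isOfFinAddOrder_heegnerPoint_cm7_discr_neg24 / _neg40`, `analyticRank_eq_one_twist_cm7_neg6 / _neg10` — the first
  PROVED rank-one `L`-values of the additive cell OUTSIDE the prime family (bsd-cm's `E4 / E8 / E88`, `n = 1, 2, 22`, have
  `7` inert in `ℚ(√−n)` and are not Heegner fields of `X₀(49)`).
* §5 (appended) the POSITIVE rank-one additive twists `49a1^{(7m)} ∼ 49a1^{(−m)}` (`7`-isogeny `E₀ ∼ E₀^{(−7)}`, seat
  c201's `isIsogenous_quadraticTwist_cm7_neg_seven_mul`): `analyticRank_eq_one_posTwist_of_thm120_evenDiscr`, instance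
  `analyticRank_eq_one_twist_cm7_pos35`.

References: [KrizLi2019] Thm. 1.20 (pp. 7–8), Rem. 1.21; [Washington1997] §5.1, Thm. 4.2; [Cox2013] §1.C Lemma 1.14;
[GrossZagier1986] I.(6.3), I.§7; [CoatesLiTianZhai2015] Thm. 1.2; [BurungaleCastellaSkinnerTian2022] Rem. D;
[SilvermanAEC2009] IV.6.4, VII.6.3, X.5.4.
-/

noncomputable section

open scoped Classical NumberTheorySymbols

open WeierstrassCurve NumberField DirichletCharacter
open Literature.NumberTheory Literature.NumberTheory.EllipticCurves
  Literature.NumberTheory.EllipticCurves.ModularForms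
open Literature.NumberTheory.EllipticCurves.KrizLi2019 Literature.NumberTheory.LFunctions
open Summit.BirchSwinnertonDyer.Rank1Residual
open Summit.BirchSwinnertonDyer.Rank1Residual.X12.O11.RouteU

namespace Summit.BirchSwinnertonDyer.BirchSwinnertonDyer.Theorems.GoldfeldGoodTwists

/-! ## §1 The Bernoulli hypothesis for an arbitrary even discriminant `d_K = −4n` -/

/-- **The Bernoulli hypothesis of Thm. 1.20 for `(X₀(49), 7, K)`, `d_K = −4n`, from ONE certificate** — the
even-discriminant generalisation of file 4's `bernoulli_hypothesis_cm7_of_cert` (there `n = q` prime): for `n` with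
`(4n, 7) = 1`, `−n ≡ 2, 3 (mod 4)` squarefree (i.e. `−4n` a fundamental discriminant), `χ` the Kronecker character mod
`4n` (values `[a odd]·(−n/a)`) lifted to any level `D` with `4n ∣ D`, and the certificate `‖B_{1,θ}‖₇ = 1` for every
`θ` mod `7·4n` with values `[j odd]·(−n/j)·ω(j)⁴`: `B_{1,ψ₀⁻¹ε_K}·B_{1,ψ₀ω⁻¹} ≢ 0 (mod 7)` for `ψ = ω²`.
[cite: KrizLi2019, Thm. 1.20 (p. 8, the Bernoulli hypothesis)] [cite: Washington1997, §5.1 and Thm. 4.2] -/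
theorem bernoulli_hypothesis_cm7_of_cert_evenDiscr (ω : DirichletCharacter ℚ_[7] 7) (hω : IsTeichmullerCharacter ω)
    {n : ℕ} [NeZero n] (h47 : (4 * n).Coprime 7) (hn4 : (-(n : ℤ)) % 4 = 2 ∨ (-(n : ℤ)) % 4 = 3)
    (hsq : Squarefree (-(n : ℤ))) (χ : DirichletCharacter ℚ_[7] (4 * n))
    (hχ : ∀ a : ℕ, χ (a : ZMod (4 * n)) = ((if Even a then (0 : ℤ) else J(-(n : ℤ) | a) : ℤ) : ℚ_[7]))
    (hcert : ∀ θ : DirichletCharacter ℚ_[7] (7 * (4 * n)),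
      (∀ j : ZMod (7 * (4 * n)), θ j =
        ((if Even j.val then (0 : ℤ) else J(-(n : ℤ) | j.val) : ℤ) : ℚ_[7]) * ω (j.val : ZMod 7) ^ 4) →
      ‖generalizedBernoulli 1 θ‖ = 1)
    {D : ℕ} [NeZero D] (hdiv : 4 * n ∣ D) :
    ¬ (‖bernoulliOnePrim (bernoulliCharOne (ω ^ 2) (changeLevel hdiv χ)) *
        bernoulliOnePrim (bernoulliCharTwo (ω ^ 2) (changeLevel hdiv χ) ω)‖ ≤ (7 : ℝ)⁻¹) := by
  have hχodd : ∀ a : ℕ, Odd a → χ (a : ZMod (4 * n)) = (J(-(n : ℤ) | a) : ℚ_[7]) := fun a ha => by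
    rw [hχ a, if_neg (Nat.not_even_iff_odd.mpr ha)]
  have hχp : χ.IsPrimitive := isPrimitive_kroneckerFour (m := -(n : ℤ)) (by simp) hn4 hsq hχodd
  have hu₁ : ‖bernoulliOnePrim (bernoulliCharOne (ω ^ 2) (changeLevel hdiv χ))‖ = 1 := by
    have hprim : (changeLevel (dvd_mul_left (4 * n) 7) χ * changeLevel (dvd_mul_right 7 (4 * n)) (ω ^ 4) :
        DirichletCharacter ℚ_[7] (7 * (4 * n))).IsPrimitive := by
      rw [thetaOneK_eq_psiK_inv ω χ _ hχ kroneckerVal_trichotomy]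
      exact psiJ_inv_isPrimitive ω χ h47 hω hχp
    rw [bernoulliCharOne_changeLevel, bernoulliOnePrim_changeLevel, bernoulliCharOne_teichmuller_sq,
      bernoulliOnePrim_eq_of_isPrimitive _ hprim]
    exact hcert _ (thetaOneK_apply ω χ _ hχ)
  exact not_norm_mul_le_inv_of_norm_eq_one hu₁
    (norm_bernoulliOnePrim_bernoulliCharTwo_teichmuller_sq ω hω (changeLevel hdiv χ))

/-! ## §2 T1′ — every even-discriminant Heegner field of `X₀(49)`: Heegner points have infinite order on the unit locus -/

/-- **T1′ (EVEN-DISCRIMINANT GENERALISATION of file 4's T1). KL19 Thm. 1.20 at `p = 7` for `X₀(49)` over ANY imaginary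
quadratic field `K` with `4 ∣ d_K` in which `7` splits.** Write `d_K = −4n` (so `n ≡ 1, 2 (mod 4)` is squarefree —
`Quadratic.isFundamentalDiscriminant_discr`); assume `(−n/7) = +1` (⟺ `7` splits in `K` ⟺ the Heegner hypothesis for `49`)
and the Bernoulli certificate for `n` (`‖B_{1,θ}‖₇ = 1` for every Teichmüller `ω` and every `θ` mod `7·4n` with values
`[j odd]·(−n/j)·ω(j)⁴`, i.e. `7 ∤ B_{1,ε_{−4n}ω⁴}`). Then, granted `KrizLi2019.thm120_padicLogHeegner_unit_of_bernoulli`,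
EVERY level-`49` Heegner point `P ∈ X₀(49)(K)` has infinite order. These `K` are EXACTLY the `2`-ramified Heegner fields
of `X₀(49)` — the «Heegner half» of the additive-at-`2` cell of S1⁺ (seat c201's sub-leaf `X049HeegnerNonTorsionEvenDiscr`,
whose CONCLUSION this is, with no Selmer hypothesis, on the unit locus); the twists `X₀(49)^{(d_K)} ≅ 49a1^{(−n)}` run over
ALL negative additive twists with `(−n/7) = +1`, not only the prime family. Same instantiation as T1 (`E = cm7`, `ψ = ω²`,
hypotheses (1)–(3), `ε_K` = the lifted Kronecker character mod `4n`, embedding `K ↪ ℚ₇` at a degree-one prime over `7`,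
`log_{ω_𝓔} P ≠ 0 ⇒ P ∉ E(K)_tors`). RANK axis, `p = 7` only. [cite: KrizLi2019, Thm. 1.20 (pp. 7–8) = Thm. 7.1, Rem. 1.21 (p. 8)]
[cite: Washington1997, §5.1] [cite: SilvermanAEC2009, IV.6.4 and VII.6.3] -/
theorem not_isOfFinAddOrder_heegnerPoint_cm7_of_thm120_evenDiscr
    (h120 : thm120_padicLogHeegner_unit_of_bernoulli) {n : ℕ} [NeZero n] (hn7 : J(-(n : ℤ) | 7) = 1)
    (hcert : ∀ (ω : DirichletCharacter ℚ_[7] 7), IsTeichmullerCharacter ω →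
      ∀ θ : DirichletCharacter ℚ_[7] (7 * (4 * n)),
        (∀ j : ZMod (7 * (4 * n)), θ j =
          ((if Even j.val then (0 : ℤ) else J(-(n : ℤ) | j.val) : ℤ) : ℚ_[7]) * ω (j.val : ZMod 7) ^ 4) →
        ‖generalizedBernoulli 1 θ‖ = 1)
    (K : Type) [Field K] [NumberField K] (hK : IsImaginaryQuadratic K)
    (hdK : NumberField.discr K = -(4 * (n : ℤ)))
    {P : (cm7.baseChange K).toAffine.Point} (hP : IsHeegnerPoint 49 cm7 K P) : ¬ IsOfFinAddOrder P := by
  haveI : Fact (Nat.Prime 7) := ⟨by norm_num⟩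
  haveI : NeZero (cm7.conductorNorm ℤ) := ⟨(cm7.conductorNorm_pos_holds).ne'⟩
  have hn0 : 0 < n := Nat.pos_of_ne_zero (NeZero.ne n)
  haveI : NeZero (NumberField.discr K).natAbs := ⟨Int.natAbs_ne_zero.mpr (by rw [hdK]; omega)⟩
  -- `d_K = −4n` is a fundamental discriminant: `−n ≡ 2, 3 (mod 4)` squarefree
  obtain ⟨hn4, hsq⟩ : ((-(n : ℤ)) % 4 = 2 ∨ (-(n : ℤ)) % 4 = 3) ∧ Squarefree (-(n : ℤ)) := by
    rcases QuadraticFields.Quadratic.isFundamentalDiscriminant_discr (K := K) hK.1 with ⟨h1, -, -⟩ | ⟨-, h2, h3⟩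
    · exfalso
      rw [hdK] at h1
      omega
    · rw [hdK, show -(4 * (n : ℤ)) / 4 = -(n : ℤ) by omega] at h2 h3
      exact ⟨h2, h3⟩
  -- `7 ∤ n` (else `(−n/7) = 0`)
  have h7n : ¬ 7 ∣ n := by
    rintro ⟨k, rfl⟩
    have h0 : (-((7 * k : ℕ) : ℤ)) % ((7 : ℕ) : ℤ) = 0 := by push_cast; omega
    rw [jacobiSym.mod_left, h0, jacobiSym.zero_left (by norm_num)] at hn7
    exact absurd hn7 (by norm_num)
  have h47 : (4 * n).Coprime 7 := by
    rw [Nat.coprime_comm, Nat.Prime.coprime_iff_not_dvd (by norm_num)]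
    intro hd
    rcases (Nat.Prime.dvd_mul (by norm_num)).mp hd with h | h
    · revert h; decide
    · exact h7n h
  -- the Heegner hypothesis for `49`, `7` split in `K`, the embedding `K ↪ ℚ₇`
  have hH : SatisfiesHeegnerHypothesis 49 K :=
    satisfiesHeegnerHypothesis_fortyNine_of_discr_eq K hK.1 (by rw [hdK]; ring) hn7
  have hH' : SatisfiesHeegnerHypothesis (cm7.conductorNorm ℤ) K := by rw [conductorNorm_cm7]; exact hH
  have h7K : ((Ideal.span {((7 : ℕ) : ℤ)}).primesOver (𝓞 K)).ncard = 2 := hH 7 (by norm_num) (by norm_num)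
  obtain ⟨𝔭, h𝔭, he, hf⟩ := X11b.exists_degreeOnePrime_of_splitsIn K 7 hK.1 h7K
  -- the datum at level `N(X₀(49))`
  obtain ⟨D, H, ι, hPH⟩ := isHeegnerPoint_of_level_eq conductorNorm_cm7.symm hP
  -- the characters `ω`, `ε_K`
  obtain ⟨ω, hω⟩ := exists_isTeichmullerCharacter (p := 7)
  obtain ⟨χ, hχ⟩ := exists_kroneckerFour (-(n : ℤ)) (by omega) (k := 4 * n) (by simp)
  have hχodd : ∀ a : ℕ, Odd a → χ (a : ZMod (4 * n)) = (J(-(n : ℤ) | a) : ℚ_[7]) := fun a ha => by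
    rw [hχ a, if_neg (Nat.not_even_iff_odd.mpr ha)]
  have hχp : χ.IsPrimitive := isPrimitive_kroneckerFour (m := -(n : ℤ)) (by simp) hn4 hsq hχodd
  have hnat : (NumberField.discr K).natAbs = 4 * n := by
    rw [hdK, Int.natAbs_neg]
    norm_cast
  have hdiv : 4 * n ∣ (NumberField.discr K).natAbs := by rw [hnat]
  have hεK : IsKroneckerCharacterOf K (changeLevel hdiv χ) :=
    isKroneckerCharacterOf_kroneckerFour hK.1 (m := -(n : ℤ)) (by rw [hdK]; ring) χ hχp hχodd (by simp) hdiv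
  -- Thm. 1.20
  have key := h120 7 (by norm_num) cm7 7 (ω ^ 2) ω (teichmuller_sq_isPrimitive ω hω) hω
    (hss_cm7_teichmuller_sq ω hω) (teichmuller_sq_apply_seven_ne_one ω)
    (primVal_invMulOmega_teichmuller_sq_seven_ne_one ω hω)
    (not_hasSplitMultiplicativeReductionAtPrime_of_hasCM cm7 hasCM_cm7')
    (fun ℓ hℓ h7 hbad => by
      haveI := Fact.mk hℓ
      exact absurd (hasGoodReductionAtPrime_cm7 ℓ h7) hbad.1)
    D K hK hH' h7K (changeLevel hdiv χ) hεK H ι (X11b.embAt K 7 𝔭 h𝔭 he hf) P hPH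
    (bernoulli_hypothesis_cm7_of_cert_evenDiscr ω hω h47 hn4 hsq χ hχ (hcert ω hω) hdiv)
  have hlog := padicLogOmega_ne_zero_of_not_norm_le key
  exact fun hfin => hlog ((X11b.R1.logOmega_eq_zero_iff cm7 7 (X11b.embAt K 7 𝔭 h𝔭 he hf) P).mpr hfin)

/-! ## §3 T2′ — `ord_{s=1} L(X₀(49)/K, s) = 1` and `ord_{s=1} L(49a1^{(−n)}, s) = 1` on the even-discriminant unit locus -/

/-- **T2′ over `K`: `ord_{s=1} L(X₀(49)/K, s) = 1` for every imaginary quadratic `K` with `d_K = −4n`, `(−n/7) = +1`,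
on the unit locus** (granted KL19, Modularity, Gross–Zagier, Heegner rationality; T1′ + the Gross–Zagier dictionary
`analyticRankEK_cm7_eq_one_of_heegner_nonTorsion`). [cite: KrizLi2019, Thm. 1.20 (pp. 7–8)] [cite: GrossZagier1986, Thm. I.(6.3)] -/
theorem analyticRankEK_cm7_eq_one_of_thm120_evenDiscr (h120 : thm120_padicLogHeegner_unit_of_bernoulli)
    (hnf : ModularForms.exists_isNewformOf)
    (hGZ : ∀ (N : ℕ) [NeZero N] (W : WeierstrassCurve ℚ) (K : Type) [Field K] [NumberField K],
      gross_zagier N W K)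
    (hHP : ∀ (W : WeierstrassCurve ℚ) (K : Type) [Field K] [NumberField K], exists_isHeegnerPoint W K)
    {n : ℕ} [NeZero n] (hn7 : J(-(n : ℤ) | 7) = 1)
    (hcert : ∀ (ω : DirichletCharacter ℚ_[7] 7), IsTeichmullerCharacter ω →
      ∀ θ : DirichletCharacter ℚ_[7] (7 * (4 * n)),
        (∀ j : ZMod (7 * (4 * n)), θ j =
          ((if Even j.val then (0 : ℤ) else J(-(n : ℤ) | j.val) : ℤ) : ℚ_[7]) * ω (j.val : ZMod 7) ^ 4) →
        ‖generalizedBernoulli 1 θ‖ = 1)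
    (K : Type) [Field K] [NumberField K] (hK : IsImaginaryQuadratic K)
    (hdK : NumberField.discr K = -(4 * (n : ℤ))) : analyticRankEK cm7 K = 1 :=
  analyticRankEK_cm7_eq_one_of_heegner_nonTorsion hnf hGZ hHP K hK
    (satisfiesHeegnerHypothesis_fortyNine_of_discr_eq K hK.1 (by rw [hdK]; ring) hn7)
    (fun _ hP => not_isOfFinAddOrder_heegnerPoint_cm7_of_thm120_evenDiscr h120 hn7 hcert K hK hdK hP)

/-- **T2′ over `ℚ` — «D(n)» on the whole Heegner half: `ord_{s=1} L(W, s) = 1` for EVERY elliptic `W/ℚ` isomorphic to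
`X₀(49)^{(−n)} = 49a1^{(−n)}`**, for every squarefree `n ≡ 1, 2 (mod 4)` with `(−n/7) = +1` (the NEGATIVE additive-at-`2`
twists whose field `ℚ(√−n)` is a Heegner field of `X₀(49)`) satisfying the Bernoulli certificate — granted KL19 Thm. 1.20
(`h120`), Modularity (`hnf`), Coates–Li–Tian–Zhai Thm. 1.2 at `R = 1` (`h12`), Gross–Zagier (`hGZ`), Heegner rationality
(`hHP`): `K = ℚ(√−n)` (`d_K = −4n`) exists, T2′ over `K`, Artin formalism `ord L(X₀(49)/K) = 0 + ord L(X₀(49)^{(d_K)})`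
(`analyticRankEK_cm7`) and `X₀(49)^{(−4n)} ≅ X₀(49)^{(−n)} ≅ W`. The prime family of file 4b is `n = q`.
[cite: KrizLi2019, Thm. 1.20 (pp. 7–8) and Rem. 1.21] [cite: CoatesLiTianZhai2015, Thm. 1.2 (p. 359, case r = 0)]
[cite: GrossZagier1986, Thm. I.(6.3) and I.§7] -/
theorem analyticRank_eq_one_negTwist_of_thm120_evenDiscr (h120 : thm120_padicLogHeegner_unit_of_bernoulli)
    (hnf : ModularForms.exists_isNewformOf) (h12 : CoatesLiTianZhai2015.thm12_fullBSD_twist)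
    (hGZ : ∀ (N : ℕ) [NeZero N] (W : WeierstrassCurve ℚ) (K : Type) [Field K] [NumberField K],
      gross_zagier N W K)
    (hHP : ∀ (W : WeierstrassCurve ℚ) (K : Type) [Field K] [NumberField K], exists_isHeegnerPoint W K)
    {n : ℕ} [NeZero n] (hn4 : n % 4 = 1 ∨ n % 4 = 2) (hsq : Squarefree n) (hn7 : J(-(n : ℤ) | 7) = 1)
    (hcert : ∀ (ω : DirichletCharacter ℚ_[7] 7), IsTeichmullerCharacter ω →
      ∀ θ : DirichletCharacter ℚ_[7] (7 * (4 * n)),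
        (∀ j : ZMod (7 * (4 * n)), θ j =
          ((if Even j.val then (0 : ℤ) else J(-(n : ℤ) | j.val) : ℤ) : ℚ_[7]) * ω (j.val : ZMod 7) ^ 4) →
        ‖generalizedBernoulli 1 θ‖ = 1)
    (W : WeierstrassCurve ℚ) [W.IsElliptic] (C : VariableChange ℚ)
    (hC : C • W = cm7.quadraticTwist ((-(n : ℤ) : ℤ) : ℚ)) : W.analyticRank = 1 := by
  have hn0 : 0 < n := Nat.pos_of_ne_zero (NeZero.ne n)
  have hmod : hasEntireLFunction_rat := hasEntireLFunction_rat_of_exists_isNewformOf hnf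
  have hsq' : Squarefree (-(n : ℤ)) := by
    rw [← Int.squarefree_natAbs, Int.natAbs_neg, Int.natAbs_natCast]
    exact hsq
  have hn0' : ((-(n : ℤ) : ℤ) : ℚ) ≠ 0 := by exact_mod_cast (show (-(n : ℤ)) ≠ 0 by omega)
  haveI := cm7.isElliptic_quadraticTwist hn0'
  -- `K = ℚ(√−n)`, `d_K = −4n`
  obtain ⟨K, _, _, h2, hdK⟩ := QuadraticFields.Quadratic.exists_numberField_discr_eq (D := 4 * (-(n : ℤ)))
    (Or.inr ⟨dvd_mul_right 4 _, by rw [show 4 * (-(n : ℤ)) / 4 = -(n : ℤ) by omega]; omega,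
      by rw [show 4 * (-(n : ℤ)) / 4 = -(n : ℤ) by omega]; exact hsq'⟩)
  have hK : IsImaginaryQuadratic K := isImaginaryQuadratic_iff_discr_neg.mpr ⟨h2, by rw [hdK]; omega⟩
  have hEK := analyticRankEK_cm7_eq_one_of_thm120_evenDiscr h120 hnf hGZ hHP hn7 hcert K hK (by rw [hdK]; ring)
  -- `X₀(49)^{(d_K)} = X₀(49)^{(4·(−n))} ≅ X₀(49)^{(−n)} ≅ W`
  have htw : cm7.quadraticTwist (NumberField.discr K : ℚ) =
      (⟨(Units.mk0 (2 : ℚ) two_ne_zero)⁻¹, 0, 0, 0⟩ : VariableChange ℚ) • cm7.quadraticTwist ((-(n : ℤ) : ℤ) : ℚ) := by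
    rw [hdK]
    exact quadraticTwist_cm7_four_mul (-(n : ℤ))
  haveI : (cm7.quadraticTwist (NumberField.discr K : ℚ)).IsElliptic := by rw [htw]; infer_instance
  have hWdK : IsIsogenous W (cm7.quadraticTwist (NumberField.discr K : ℚ)) := by
    rw [htw]
    exact (isIsogenous_of_smul_eq hC).trans' (isIsogenous_smul _ _)
  rw [analyticRankEK_cm7 hmod h12 K, ← analyticRank_eq_of_isIsogenous' hWdK] at hEK
  exact hEK

/-- **K12₂″ (item 20044) ON THE HEEGNER HALF, UNIT LOCUS** — the conclusion `ord_{s=1} L(W, s) = 1` of the route decl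
`RankOneTwoConverseCMSevenAdditiveTwo` holds OUTRIGHT for every model `W` of `49a1^{(−n)}`, `n ≡ 1, 2 (mod 4)` squarefree,
`(−n/7) = +1`, with the Bernoulli certificate (no Selmer hypothesis used). [cite: KrizLi2019, Thm. 1.20 (pp. 7–8)]
[cite: BurungaleCastellaSkinnerTian2022, Rem. D (p. 327)] -/
theorem rankOneTwoConverse_negTwist_of_thm120_evenDiscr (h120 : thm120_padicLogHeegner_unit_of_bernoulli)
    (hnf : ModularForms.exists_isNewformOf) (h12 : CoatesLiTianZhai2015.thm12_fullBSD_twist)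
    (hGZ : ∀ (N : ℕ) [NeZero N] (W : WeierstrassCurve ℚ) (K : Type) [Field K] [NumberField K],
      gross_zagier N W K)
    (hHP : ∀ (W : WeierstrassCurve ℚ) (K : Type) [Field K] [NumberField K], exists_isHeegnerPoint W K)
    {n : ℕ} [NeZero n] (hn4 : n % 4 = 1 ∨ n % 4 = 2) (hsq : Squarefree n) (hn7 : J(-(n : ℤ) | 7) = 1)
    (hcert : ∀ (ω : DirichletCharacter ℚ_[7] 7), IsTeichmullerCharacter ω →
      ∀ θ : DirichletCharacter ℚ_[7] (7 * (4 * n)),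
        (∀ j : ZMod (7 * (4 * n)), θ j =
          ((if Even j.val then (0 : ℤ) else J(-(n : ℤ) | j.val) : ℤ) : ℚ_[7]) * ω (j.val : ZMod 7) ^ 4) →
        ‖generalizedBernoulli 1 θ‖ = 1)
    (W : WeierstrassCurve ℚ) [W.IsElliptic] (C : VariableChange ℚ)
    (hC : C • W = cm7.quadraticTwist ((-(n : ℤ) : ℤ) : ℚ)) :
    W.selmerCorank 2 = 1 → W.analyticRank = 1 :=
  fun _ => analyticRank_eq_one_negTwist_of_thm120_evenDiscr h120 hnf h12 hGZ hHP hn4 hsq hn7 hcert W C hC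

/-! ## §4 Two COMPOSITE members certified by bsd-cm: `n = 6` (`49a1^{(−6)}`, `d_K = −24`) and `n = 10`
(`49a1^{(−10)}`, `d_K = −40`) — beyond the prime family -/

/-- **Every level-`49` Heegner point of `X₀(49)` over `K = ℚ(√−6)` (`d_K = −24`) has infinite order**, granted KL19
Thm. 1.20 — bsd-cm's kernel certificate `RouteU.norm_generalizedBernoulli_theta1_E24`; `(−6/7) = +1`.
[cite: KrizLi2019, Thm. 1.20 (pp. 7–8) and Rem. 1.21] [cite: Washington1997, §5.1 and Thm. 4.2] -/
theorem not_isOfFinAddOrder_heegnerPoint_cm7_discr_neg24 (h120 : thm120_padicLogHeegner_unit_of_bernoulli)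
    (K : Type) [Field K] [NumberField K] (hK : IsImaginaryQuadratic K) (hdK : NumberField.discr K = -24)
    {P : (cm7.baseChange K).toAffine.Point} (hP : IsHeegnerPoint 49 cm7 K P) : ¬ IsOfFinAddOrder P :=
  not_isOfFinAddOrder_heegnerPoint_cm7_of_thm120_evenDiscr h120 (n := 6) (by norm_num)
    norm_generalizedBernoulli_theta1_E24 K hK (by rw [hdK]; norm_num) hP

/-- **Every level-`49` Heegner point of `X₀(49)` over `K = ℚ(√−10)` (`d_K = −40`) has infinite order**, granted KL19
Thm. 1.20 — bsd-cm's kernel certificate `RouteU.norm_generalizedBernoulli_theta1_E40`; `(−10/7) = +1`.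
[cite: KrizLi2019, Thm. 1.20 (pp. 7–8) and Rem. 1.21] [cite: Washington1997, §5.1 and Thm. 4.2] -/
theorem not_isOfFinAddOrder_heegnerPoint_cm7_discr_neg40 (h120 : thm120_padicLogHeegner_unit_of_bernoulli)
    (K : Type) [Field K] [NumberField K] (hK : IsImaginaryQuadratic K) (hdK : NumberField.discr K = -40)
    {P : (cm7.baseChange K).toAffine.Point} (hP : IsHeegnerPoint 49 cm7 K P) : ¬ IsOfFinAddOrder P :=
  not_isOfFinAddOrder_heegnerPoint_cm7_of_thm120_evenDiscr h120 (n := 10) (by norm_num)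
    norm_generalizedBernoulli_theta1_E40 K hK (by rw [hdK]; norm_num) hP

/-- **«D(6)»: `ord_{s=1} L(W, s) = 1` for every elliptic `W/ℚ` isomorphic to `49a1^{(−6)}`** (conductor `784·36`;
a COMPOSITE additive twist, outside the prime family), granted KL19, Modularity, CLTZ Thm. 1.2, Gross–Zagier, Heegner
rationality (certificate `RouteU.norm_generalizedBernoulli_theta1_E24`). [cite: KrizLi2019, Thm. 1.20 (pp. 7–8)]
[cite: GrossZagier1986, Thm. I.(6.3) and I.§7] -/
theorem analyticRank_eq_one_twist_cm7_neg6 (h120 : thm120_padicLogHeegner_unit_of_bernoulli)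
    (hnf : ModularForms.exists_isNewformOf) (h12 : CoatesLiTianZhai2015.thm12_fullBSD_twist)
    (hGZ : ∀ (N : ℕ) [NeZero N] (W : WeierstrassCurve ℚ) (K : Type) [Field K] [NumberField K],
      gross_zagier N W K)
    (hHP : ∀ (W : WeierstrassCurve ℚ) (K : Type) [Field K] [NumberField K], exists_isHeegnerPoint W K)
    (W : WeierstrassCurve ℚ) [W.IsElliptic] (C : VariableChange ℚ) (hC : C • W = cm7.quadraticTwist (-6)) :
    W.analyticRank = 1 :=
  analyticRank_eq_one_negTwist_of_thm120_evenDiscr h120 hnf h12 hGZ hHP (n := 6) (by norm_num)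
    (by rw [show (6 : ℕ) = 2 * 3 by norm_num, Nat.squarefree_mul_iff]; norm_num [Nat.prime_two.squarefree, Nat.prime_three.squarefree])
    (by norm_num) norm_generalizedBernoulli_theta1_E24 W C (by rw [hC]; norm_num)

/-- **«D(10)»: `ord_{s=1} L(W, s) = 1` for every elliptic `W/ℚ` isomorphic to `49a1^{(−10)}`** (a composite additive
twist), granted the same five named facts (certificate `RouteU.norm_generalizedBernoulli_theta1_E40`).
[cite: KrizLi2019, Thm. 1.20 (pp. 7–8)] [cite: GrossZagier1986, Thm. I.(6.3) and I.§7] -/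
theorem analyticRank_eq_one_twist_cm7_neg10 (h120 : thm120_padicLogHeegner_unit_of_bernoulli)
    (hnf : ModularForms.exists_isNewformOf) (h12 : CoatesLiTianZhai2015.thm12_fullBSD_twist)
    (hGZ : ∀ (N : ℕ) [NeZero N] (W : WeierstrassCurve ℚ) (K : Type) [Field K] [NumberField K],
      gross_zagier N W K)
    (hHP : ∀ (W : WeierstrassCurve ℚ) (K : Type) [Field K] [NumberField K], exists_isHeegnerPoint W K)
    (W : WeierstrassCurve ℚ) [W.IsElliptic] (C : VariableChange ℚ) (hC : C • W = cm7.quadraticTwist (-10)) :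
    W.analyticRank = 1 :=
  analyticRank_eq_one_negTwist_of_thm120_evenDiscr h120 hnf h12 hGZ hHP (n := 10) (by norm_num)
    (by rw [show (10 : ℕ) = 2 * 5 by norm_num, Nat.squarefree_mul_iff]; norm_num [Nat.prime_two.squarefree, Nat.prime_five.squarefree])
    (by norm_num) norm_generalizedBernoulli_theta1_E40 W C (by rw [hC]; norm_num)

/-! ## §5 (appended) The POSITIVE rank-one additive twists `49a1^{(7m)}`: the `7`-isogeny `E₀ ∼ E₀^{(−7)}` -/

/-- **«D» for the positive additive twists of odd analytic rank: `ord_{s=1} L(W, s) = 1` for every elliptic `W/ℚ`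
isomorphic to `49a1^{(7m)}`**, `m ≡ 1, 2 (mod 4)` squarefree with `(−m/7) = +1` and the Bernoulli certificate for `m`
(granted KL19, Modularity, CLTZ Thm. 1.2, Gross–Zagier, Heegner rationality). The additive-at-`2` twists `49a1^{(d)}` of
root number `−1` are `d < 0`, `7 ∤ d` and `d = 7m > 0` (`w = sgn(d)·(−1)^{[7∣d]}`, seat c301 gen 3); the latter are
`ℚ`-ISOGENOUS to `49a1^{(−m)}` by the kernel-certified `7`-isogeny `E₀ ∼ E₀^{(−7)}` twisted by `−m` (seat c201's
`isIsogenous_quadraticTwist_cm7_neg_seven_mul`, `[√−7] ∈ End E₀`), and the analytic rank is an isogeny invariant, so §3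
applies with `n = m`. Together with §3 this covers EVERY rank-one additive twist whose isogeny orbit meets the Heegner half.
[cite: CoatesLiTianZhai2015, §1 (p. 359, "A^{(d)} and A^{(−7d)} are isogenous over ℚ")] [cite: KrizLi2019, Thm. 1.20 (pp. 7–8)]
[cite: GrossZagier1986, Thm. I.(6.3) and I.§7] -/
theorem analyticRank_eq_one_posTwist_of_thm120_evenDiscr (h120 : thm120_padicLogHeegner_unit_of_bernoulli)
    (hnf : ModularForms.exists_isNewformOf) (h12 : CoatesLiTianZhai2015.thm12_fullBSD_twist)
    (hGZ : ∀ (N : ℕ) [NeZero N] (W : WeierstrassCurve ℚ) (K : Type) [Field K] [NumberField K],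
      gross_zagier N W K)
    (hHP : ∀ (W : WeierstrassCurve ℚ) (K : Type) [Field K] [NumberField K], exists_isHeegnerPoint W K)
    {m : ℕ} [NeZero m] (hm4 : m % 4 = 1 ∨ m % 4 = 2) (hsq : Squarefree m) (hm7 : J(-(m : ℤ) | 7) = 1)
    (hcert : ∀ (ω : DirichletCharacter ℚ_[7] 7), IsTeichmullerCharacter ω →
      ∀ θ : DirichletCharacter ℚ_[7] (7 * (4 * m)),
        (∀ j : ZMod (7 * (4 * m)), θ j =
          ((if Even j.val then (0 : ℤ) else J(-(m : ℤ) | j.val) : ℤ) : ℚ_[7]) * ω (j.val : ZMod 7) ^ 4) →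
        ‖generalizedBernoulli 1 θ‖ = 1)
    (W : WeierstrassCurve ℚ) [W.IsElliptic] (C : VariableChange ℚ)
    (hC : C • W = cm7.quadraticTwist (((7 * m : ℕ) : ℤ) : ℚ)) : W.analyticRank = 1 := by
  have hm0 : 0 < m := Nat.pos_of_ne_zero (NeZero.ne m)
  have hneg : (-(m : ℤ)) ≠ 0 := by omega
  have hnegQ : ((-(m : ℤ) : ℤ) : ℚ) ≠ 0 := by exact_mod_cast hneg
  haveI := cm7.isElliptic_quadraticTwist hnegQ
  -- the reference model `X₀(49)^{(−m)}` has analytic rank one (§3 with `C = 1`)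
  have hneg1 : (cm7.quadraticTwist ((-(m : ℤ) : ℤ) : ℚ)).analyticRank = 1 :=
    analyticRank_eq_one_negTwist_of_thm120_evenDiscr h120 hnf h12 hGZ hHP hm4 hsq hm7 hcert
      (cm7.quadraticTwist ((-(m : ℤ) : ℤ) : ℚ)) 1 (one_smul _ _)
  -- `X₀(49)^{(−m)} ∼ X₀(49)^{(7m)} ≅ W`
  have hiso : IsIsogenous (cm7.quadraticTwist ((-(m : ℤ) : ℤ) : ℚ)) (cm7.quadraticTwist (((7 * m : ℕ) : ℤ) : ℚ)) := by
    have h := isIsogenous_quadraticTwist_cm7_neg_seven_mul hneg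
    rwa [show (-7 * -(m : ℤ) : ℤ) = ((7 * m : ℕ) : ℤ) by push_cast; ring] at h
  have hW : IsIsogenous (cm7.quadraticTwist ((-(m : ℤ) : ℤ) : ℚ)) W := hiso.trans' (isIsogenous_of_smul_eq' hC)
  rw [← analyticRank_eq_of_isIsogenous' hW]
  exact hneg1

/-- **Instance: `ord_{s=1} L(W, s) = 1` for every elliptic `W/ℚ` isomorphic to `49a1^{(35)}`** (`= 49a1^{(7·5)} ∼ 49a1^{(−5)}`;
bsd-cm certificate `RouteU.norm_generalizedBernoulli_theta1_E20`), granted the five named facts.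
[cite: KrizLi2019, Thm. 1.20 (pp. 7–8)] [cite: CoatesLiTianZhai2015, §1 (p. 359)] -/
theorem analyticRank_eq_one_twist_cm7_pos35 (h120 : thm120_padicLogHeegner_unit_of_bernoulli)
    (hnf : ModularForms.exists_isNewformOf) (h12 : CoatesLiTianZhai2015.thm12_fullBSD_twist)
    (hGZ : ∀ (N : ℕ) [NeZero N] (W : WeierstrassCurve ℚ) (K : Type) [Field K] [NumberField K],
      gross_zagier N W K)
    (hHP : ∀ (W : WeierstrassCurve ℚ) (K : Type) [Field K] [NumberField K], exists_isHeegnerPoint W K)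
    (W : WeierstrassCurve ℚ) [W.IsElliptic] (C : VariableChange ℚ) (hC : C • W = cm7.quadraticTwist 35) :
    W.analyticRank = 1 :=
  haveI : Fact (Nat.Prime 5) := ⟨by norm_num⟩
  analyticRank_eq_one_posTwist_of_thm120_evenDiscr h120 hnf h12 hGZ hHP (m := 5) (by norm_num)
    Nat.prime_five.squarefree (by norm_num) norm_generalizedBernoulli_theta1_E20 W C (by rw [hC]; norm_num)

end Summit.BirchSwinnertonDyer.BirchSwinnertonDyer.Theorems.GoldfeldGoodTwists

end
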